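import Literature.Topology.FourManifolds.SurfaceGroupNielsenSetup
import HarnessLib

/-!
# Nielsen's lifting theorem after Zieschang: the degree form on the relation subgroup

Topic `Literature/Topology/FourManifolds`.  First properties of Zieschang's degree form
`θ = relatorDegree g = ω_{ξ₀,η₀}` (`SurfaceGroupNielsenSetup.lean`; ZVC LNM 835, Lemma 5.5.1) on
the relation subgroup `N̂ = ker (F⟨a,b⟩ ↠ S_g)`: the first two Heisenberg coordinates vanish on
`N̂` (it lies in the commutator subgroup), so on `N̂` the form `θ` is additive and conjugation
invariant; `θ(r_g) = g`, `θ(r_g^{ε}) = ε g`, and the degree of a signed product of conjugates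
`∏ Kⱼ r_g^{εⱼ} Kⱼ⁻¹` is `g · ∑ εⱼ` (`relatorDegree_conjProd`) — i.e. `θ/g` is the homomorphism
`N̂ → ℤ`, `K r_g^{ε} K⁻¹ ↦ ε`, of ZVC 5.5.1.

## References

* H. Zieschang, E. Vogt, H.-D. Coldewey, *Surfaces and Planar Discontinuous Groups*, LNM 835
  (1980), Lemma 5.5.1. [ZieschangVogtColdewey1980]
-/

noncomputable section

namespace Literature.Topology.FourManifolds

open Literature.GroupTheory.CombinatorialGroupTheory List

namespace SurfaceGroup

variable {g : ℕ}

/-! ## The degree form on the relation subgroup -/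

/-- The first Heisenberg coordinate as an additive character. [folklore] -/
def heisA (ξ η : surfaceGen g → ℤ) : FreeGroup (surfaceGen g) →* Multiplicative ℤ where
  toFun x := Multiplicative.ofAdd (heisHom ξ η x).a
  map_one' := by simp
  map_mul' x y := by simp [ofAdd_add]

/-- The second Heisenberg coordinate as an additive character. [folklore] -/
def heisB (ξ η : surfaceGen g → ℤ) : FreeGroup (surfaceGen g) →* Multiplicative ℤ where
  toFun x := Multiplicative.ofAdd (heisHom ξ η x).b
  map_one' := by simp
  map_mul' x y := by simp [ofAdd_add]

/-- The relator has vanishing first and second Heisenberg coordinates (it is a product of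
commutators). [folklore] -/
theorem heisHom_surfaceRelator_ab (ξ η : surfaceGen g → ℤ) :
    (heisHom ξ η (surfaceRelator g)).a = 0 ∧ (heisHom ξ η (surfaceRelator g)).b = 0 := by
  constructor
  · have h : heisA ξ η (surfaceRelator g) = 1 := by
      unfold surfaceRelator
      rw [map_list_prod, List.map_map]
      apply List.prod_eq_one
      intro x hx
      rw [List.mem_map] at hx
      obtain ⟨i, -, rfl⟩ := hx
      simp only [Function.comp_apply, map_mul, map_inv]
      change Multiplicative.ofAdd _ * Multiplicative.ofAdd _ * (Multiplicative.ofAdd _)⁻¹ *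
        (Multiplicative.ofAdd _)⁻¹ = 1
      rw [← ofAdd_neg, ← ofAdd_neg, ← ofAdd_add, ← ofAdd_add, ← ofAdd_add, ← ofAdd_zero]
      congr 1; ring
    simpa [heisA] using h
  · have h : heisB ξ η (surfaceRelator g) = 1 := by
      unfold surfaceRelator
      rw [map_list_prod, List.map_map]
      apply List.prod_eq_one
      intro x hx
      rw [List.mem_map] at hx
      obtain ⟨i, -, rfl⟩ := hx
      simp only [Function.comp_apply, map_mul, map_inv]
      change Multiplicative.ofAdd _ * Multiplicative.ofAdd _ * (Multiplicative.ofAdd _)⁻¹ *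
        (Multiplicative.ofAdd _)⁻¹ = 1
      rw [← ofAdd_neg, ← ofAdd_neg, ← ofAdd_add, ← ofAdd_add, ← ofAdd_add, ← ofAdd_zero]
      congr 1; ring
    simpa [heisB] using h

/-- Elements of the relation subgroup have vanishing first and second Heisenberg coordinates.
[folklore] -/
theorem heisHom_ab_of_mem_ker (ξ η : surfaceGen g → ℤ) {x : FreeGroup (surfaceGen g)}
    (hx : x ∈ (proj g).ker) : (heisHom ξ η x).a = 0 ∧ (heisHom ξ η x).b = 0 := by
  rw [mem_ker_proj_iff] at hx
  have hA : Subgroup.normalClosure ({surfaceRelator g} : Set (FreeGroup (surfaceGen g))) ≤ (heisA ξ η).ker := by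
    refine Subgroup.normalClosure_le_normal ?_
    intro y hy
    rw [Set.mem_singleton_iff] at hy
    subst hy
    rw [SetLike.mem_coe, MonoidHom.mem_ker]
    change Multiplicative.ofAdd _ = 1
    rw [(heisHom_surfaceRelator_ab ξ η).1]; rfl
  have hB : Subgroup.normalClosure ({surfaceRelator g} : Set (FreeGroup (surfaceGen g))) ≤ (heisB ξ η).ker := by
    refine Subgroup.normalClosure_le_normal ?_
    intro y hy
    rw [Set.mem_singleton_iff] at hy
    subst hy
    rw [SetLike.mem_coe, MonoidHom.mem_ker]
    change Multiplicative.ofAdd _ = 1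
    rw [(heisHom_surfaceRelator_ab ξ η).2]; rfl
  have ha := hA hx
  have hb := hB hx
  rw [MonoidHom.mem_ker] at ha hb
  exact ⟨toAdd_eq_zero.2 ha, toAdd_eq_zero.2 hb⟩

/-- **Conjugation invariance of the degree on the relation subgroup.**
[cite: ZieschangVogtColdewey1980, 5.5.1] -/
theorem relatorDegree_conj_of_mem_ker (c : FreeGroup (surfaceGen g)) {x : FreeGroup (surfaceGen g)}
    (hx : x ∈ (proj g).ker) : relatorDegree g (c * x * c⁻¹) = relatorDegree g x := by
  obtain ⟨ha, hb⟩ := heisHom_ab_of_mem_ker (degXi g) (degEta g) hx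
  unfold relatorDegree omega
  rw [map_mul, map_mul, map_inv, Heis.conj_c _ _ ha hb]

/-- The degree is additive on the relation subgroup. [cite: ZieschangVogtColdewey1980, 5.5.1] -/
theorem relatorDegree_mul_of_mem_ker {x y : FreeGroup (surfaceGen g)}
    (hx : x ∈ (proj g).ker) : relatorDegree g (x * y) = relatorDegree g x + relatorDegree g y := by
  obtain ⟨ha, -⟩ := heisHom_ab_of_mem_ker (degXi g) (degEta g) hx
  unfold relatorDegree omega
  rw [map_mul, Heis.mul_c, ha, zero_mul, add_zero]

/-- **The degree of the relator is `g`.** [cite: ZieschangVogtColdewey1980, 5.5.1] -/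
theorem relatorDegree_surfaceRelator : relatorDegree g (surfaceRelator g) = g := by
  unfold relatorDegree
  rw [← mk_surfaceWordStd, omega_surfaceWordStd]
  simp [degXi, degEta]

/-- The degree of `r^{ε}` is `ε g`. [folklore] -/
theorem relatorDegree_surfaceRelator_zpow_bsign (s : Bool) :
    relatorDegree g (surfaceRelator g ^ bsign s) = bsign s * g := by
  cases s
  · simp only [bsign, Bool.false_eq_true, ↓reduceIte, zpow_neg, zpow_one, neg_mul, one_mul]
    have hr : surfaceRelator g ∈ (proj g).ker := by
      rw [MonoidHom.mem_ker]; exact mk_surfaceRelator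
    obtain ⟨ha, hb⟩ := heisHom_ab_of_mem_ker (degXi g) (degEta g) hr
    have h := relatorDegree_surfaceRelator (g := g)
    unfold relatorDegree omega at h ⊢
    rw [map_inv, Heis.inv_c, ha, zero_mul, add_zero, h]
  · simp [bsign, relatorDegree_surfaceRelator]

/-- **The degree of a signed product of conjugates is `g` times its signed count.**
[cite: ZieschangVogtColdewey1980, 5.5.1] -/
theorem relatorDegree_conjProd (L : List (FreeGroup (surfaceGen g) × Bool)) :
    relatorDegree g (conjProd L) = g * signSum L := by
  induction L with
  | nil => simp [conjProd, signSum, relatorDegree, omega]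
  | cons p L ih =>
    rw [conjProd_cons, signSum_cons]
    have hmem : p.1 * surfaceRelator g ^ bsign p.2 * p.1⁻¹ ∈ (proj g).ker := by
      rw [MonoidHom.mem_ker, map_mul, map_mul, map_zpow, mk_surfaceRelator, one_zpow, mul_one,
        ← map_mul, mul_inv_cancel, map_one]
    have hr : surfaceRelator g ^ bsign p.2 ∈ (proj g).ker := by
      rw [MonoidHom.mem_ker, map_zpow, mk_surfaceRelator, one_zpow]
    rw [relatorDegree_mul_of_mem_ker hmem, ih, relatorDegree_conj_of_mem_ker _ hr,
      relatorDegree_surfaceRelator_zpow_bsign]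
    ring

end SurfaceGroup

end Literature.Topology.FourManifolds

end
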